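/- Width seat `ym-line-cbag-p1-w3` (prover-ym-line-cbag-p1-w3-g18-0), LINE 7b (`GlueballBandRecursion`, volume-comparison line): the
TUBE-RATE TWIN FROM THE FINITE CURRENCY — the thermal free energy of the spatial torus is the dyadic sum of cold log-defects of FINITE
boxes, so the jet stub in the tube-rate form (`ThermalFreeEnergyVolumeJets`, v1 of `…ThermalFreeEnergyDefs`) and the jet stub in the
finite form (`ColdFreeEnergyVolumeJets`, v2) are EQUIVALENT.  Sorry-free; `--supports stmt-QuantumFields-22957 --as helper`. -/
import Summits.QuantumFields.YangMills.Theorems.GlueballBandRecursionColdDefectComparisonOfJets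
import HarnessLib

/-!
# Route `GlueballBandRecursion`, line 7b: thermal jets from cold jets (dyadic telescoping)

Objects (`…ThermalFreeEnergyDefs`): `thermalLogZ ρ a t z = log Z(a³×t)(z) − t·e_a(z)` (thermal free energy of the spatial torus
`(ℤ/a)³` at period `t`, `e_a` the tube rate), `volumeDiscrepancy ρ a a' t z = thermalLogZ ρ a' t z/a'³ − thermalLogZ ρ a t z/a³`,
and the finite currency `coldLogDefect ρ a t z = 2·log Z(a³×t)(z) − log Z(a³×2t)(z) = 2·thermalLogZ ρ a t z − thermalLogZ ρ a (2t) z`,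
`coldVolumeDiscrepancy ρ a a' t z = coldLogDefect ρ a' t z/a'³ − coldLogDefect ρ a t z/a³`.

Proved here, for a compact group `G`, a continuous `ρ` and `r_ρ = strongCouplingRadius ρ`:

* §1 period-UNIFORM disc bounds: `‖thermalLogZ ρ a T z‖ ≤ 48e·a³` on `‖z‖ ≤ r_ρ` for every `T ≥ 1` (the tube bound `12a³Te^{−⌊T/2⌋}`
  through `tube_error_le_quarter`), hence `‖volumeDiscrepancy‖ ≤ 96e`, `‖coldVolumeDiscrepancy‖ ≤ 288e` uniformly in the period
  (the bounds `24t` / `96t` of the companion files are not summable against the dyadic weights `2^{−k}`);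
* §2 DYADIC TELESCOPING: `2^{−(k+1)}·coldLogDefect(a, 2^k t) = 2^{−k}·thermalLogZ(a, 2^k t) − 2^{−(k+1)}·thermalLogZ(a, 2^{k+1} t)`, so
  `thermalLogZ ρ a t z = Σ_{k<K} 2^{−(k+1)}·coldLogDefect ρ a (2^k t) z + 2^{−K}·thermalLogZ ρ a (2^K t) z` for every `K`, the same for the
  volume discrepancies, and on the closed disc `thermalLogZ ρ a t z = Σ_{k≥0} 2^{−(k+1)}·coldLogDefect ρ a (2^k t) z` (`HasSum`; the remainder is
  `≤ 48e·a³·2^{−K}`): the thermal free energy — defined through the tube rate, a limit — is recovered from finitely many finite boxes to any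
  accuracy;
* §3 JETS: if `coldVolumeDiscrepancy ρ a a' (2^k t) =O[𝓝 0] z^m` for every `k`, then `‖volumeDiscrepancy ρ a a' t z‖ ≤ 288e·(‖z‖/(r_ρ/2))^m` on
  `‖z‖ ≤ r_ρ/2` (Schwarz lemma with multiplicity per `k`, §1's period-uniform bound, geometric weights) and so `volumeDiscrepancy ρ a a' t
  =O[𝓝 0] z^m`; conversely `coldVolumeDiscrepancy(t) = 2·volumeDiscrepancy(t) − volumeDiscrepancy(2t)` transfers jets the other way;
* §4 the two typed jet stubs of line 7b are equivalent: `thermalFreeEnergyVolumeJets_of_coldJets : ColdFreeEnergyVolumeJets →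
  ThermalFreeEnergyVolumeJets`, `coldFreeEnergyVolumeJets_of_thermalJets`, `thermalFreeEnergyVolumeJets_iff_coldJets`.  With the LEAD's
  `coldFreeEnergyVolumeJets_holds` (in progress) BOTH stubs are discharged and both assemblies (`…VolumeComparisonOfJets`,
  `…ColdDefectComparisonOfJets`) fire.

HONEST FRAMING.  Elementary complex analysis / bookkeeping for the ∃-window strong-coupling rung `ColdDoublingRecursionSmallCoupling`
(RECORD-type).  Item ⟨stmt-QuantumFields-22957⟩ (the one-glueball band), the typed-window statements `TraceExcessVolumeComparison` /
`ColdDoublingRecursionStrongCoupling`, and a fortiori the Yang–Mills mass gap / the summit `YangMills` are NOT proved or advanced here.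
-/

set_option autoImplicit false

noncomputable section

open Filter Topology Asymptotics MeasureTheory
open Literature.MathematicalPhysics.QuantumFieldTheory
open Literature.MathematicalPhysics.QuantumFieldTheory.Balaban1983to89.Missing

namespace Summit.QuantumFields.YangMills.Theorems.GlueballBandRecursion.Thermal

variable {G : Type*} [Group G] [TopologicalSpace G] [IsTopologicalGroup G] [CompactSpace G] [MeasurableSpace G] [BorelSpace G]
  {n : ℕ} (ρ : G →* Matrix (Fin n) (Fin n) ℂ)

/-! ## §1 Period-uniform bounds on the strong-coupling disc -/

section UniformBounds

/-- **Period-uniform tube bound**: `‖thermalLogZ ρ a T z‖ ≤ 48e·a³` on `‖z‖ ≤ r_ρ`, for every `T ≥ 1` (from `12a³Te^{−⌊T/2⌋} ≤ 48e·a³·e^{−T/4}`). -/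
theorem norm_thermalLogZ_le_unif (hρ : Continuous ρ) {a T : ℕ} (ha : 0 < a) (hT : 1 ≤ T) {z : ℂ}
    (hz : ‖z‖ ≤ strongCouplingRadius ρ) : ‖thermalLogZ ρ a T z‖ ≤ 48 * Real.exp 1 * (a : ℝ) ^ 3 := by
  refine (norm_thermalLogZ_le ρ hρ ha hT hz).trans ((tube_error_le_quarter a T).trans ?_)
  have h1 : Real.exp (-(1 / 4 * (T : ℝ))) ≤ 1 := Real.exp_le_one_iff.2 (by have : (0 : ℝ) ≤ T := Nat.cast_nonneg T; nlinarith)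
  have h0 : (0 : ℝ) ≤ 48 * Real.exp 1 * (a : ℝ) ^ 3 := by positivity
  nlinarith [mul_le_mul_of_nonneg_left h1 h0]

/-- `‖thermalLogZ ρ a T z / a³‖ ≤ 48e` on the disc, uniformly in the period `T ≥ 1`. -/
theorem norm_thermalLogZ_div_le_unif (hρ : Continuous ρ) {a T : ℕ} (ha : 0 < a) (hT : 1 ≤ T) {z : ℂ}
    (hz : ‖z‖ ≤ strongCouplingRadius ρ) : ‖thermalLogZ ρ a T z / ((a : ℂ) ^ 3)‖ ≤ 48 * Real.exp 1 := by
  have ha3 : (0 : ℝ) < (a : ℝ) ^ 3 := by positivity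
  rw [norm_div, norm_pow, Complex.norm_natCast, div_le_iff₀ ha3]
  exact norm_thermalLogZ_le_unif ρ hρ ha hT hz

/-- `‖volumeDiscrepancy ρ a a' T z‖ ≤ 96e` on the disc, uniformly in the period `T ≥ 1`. -/
theorem norm_volumeDiscrepancy_le_unif (hρ : Continuous ρ) {a a' T : ℕ} (ha : 0 < a) (ha' : 0 < a') (hT : 1 ≤ T) {z : ℂ}
    (hz : ‖z‖ ≤ strongCouplingRadius ρ) : ‖volumeDiscrepancy ρ a a' T z‖ ≤ 96 * Real.exp 1 := by
  unfold volumeDiscrepancy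
  refine (norm_sub_le _ _).trans ?_
  have h1 := norm_thermalLogZ_div_le_unif ρ hρ ha' hT hz
  have h2 := norm_thermalLogZ_div_le_unif ρ hρ ha hT hz
  linarith

/-- The finite currency in terms of the thermal one, for the volume discrepancies:
`coldVolumeDiscrepancy ρ a a' t = 2·volumeDiscrepancy ρ a a' t − volumeDiscrepancy ρ a a' (2t)` (the tube rates cancel). -/
theorem coldVolumeDiscrepancy_eq (a a' t : ℕ) (z : ℂ) :
    coldVolumeDiscrepancy ρ a a' t z = 2 * volumeDiscrepancy ρ a a' t z - volumeDiscrepancy ρ a a' (2 * t) z := by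
  unfold coldVolumeDiscrepancy volumeDiscrepancy
  rw [coldLogDefect_eq, coldLogDefect_eq]
  ring

/-- `‖coldVolumeDiscrepancy ρ a a' T z‖ ≤ 288e` on the disc, uniformly in the period `T ≥ 1`. -/
theorem norm_coldVolumeDiscrepancy_le_unif (hρ : Continuous ρ) {a a' T : ℕ} (ha : 0 < a) (ha' : 0 < a') (hT : 1 ≤ T) {z : ℂ}
    (hz : ‖z‖ ≤ strongCouplingRadius ρ) : ‖coldVolumeDiscrepancy ρ a a' T z‖ ≤ 288 * Real.exp 1 := by
  rw [coldVolumeDiscrepancy_eq]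
  refine (norm_sub_le _ _).trans ?_
  have h1 := norm_volumeDiscrepancy_le_unif ρ hρ ha ha' hT hz
  have h2 := norm_volumeDiscrepancy_le_unif ρ hρ ha ha' (T := 2 * T) (by omega) hz
  rw [norm_mul, Complex.norm_ofNat]
  linarith

/-- **Jets ⇒ estimate, period-uniform** (Schwarz lemma with multiplicity): if `coldVolumeDiscrepancy ρ a a' T =O[𝓝 0] z^m` then
`‖coldVolumeDiscrepancy ρ a a' T z‖ ≤ 288e·(‖z‖/(r_ρ/2))^m` for `‖z‖ ≤ r_ρ/2`, with a constant that does not depend on `T`. -/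
theorem norm_coldVolumeDiscrepancy_le_of_isBigO_unif (hρ : Continuous ρ) {a a' T m : ℕ} (ha : 0 < a) (ha' : 0 < a') (hT : 1 ≤ T)
    (hO : (fun z : ℂ => coldVolumeDiscrepancy ρ a a' T z) =O[𝓝 (0 : ℂ)] fun z : ℂ => z ^ m)
    {z : ℂ} (hz : ‖z‖ ≤ strongCouplingRadius ρ / 2) :
    ‖coldVolumeDiscrepancy ρ a a' T z‖ ≤ 288 * Real.exp 1 * (‖z‖ / (strongCouplingRadius ρ / 2)) ^ m := by
  have hr := strongCouplingRadius_pos ρ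
  refine norm_le_of_isBigO_pow (differentiableOn_coldVolumeDiscrepancy ρ hρ a a' T) (fun w hw => ?_) hO (half_pos hr)
    (half_lt_self hr) hz
  rw [Metric.mem_ball, dist_zero_right] at hw
  exact norm_coldVolumeDiscrepancy_le_unif ρ hρ ha ha' hT hw.le

end UniformBounds

/-! ## §2 Dyadic telescoping: the thermal free energy from finitely many finite boxes -/

section Telescoping

/-- One dyadic step: `2^{−(k+1)}·coldLogDefect(a, 2^k t) = 2^{−k}·thermalLogZ(a, 2^k t) − 2^{−(k+1)}·thermalLogZ(a, 2^{k+1} t)`. -/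
theorem inv_two_pow_mul_coldLogDefect (a t k : ℕ) (z : ℂ) :
    ((2 : ℂ) ^ (k + 1))⁻¹ * coldLogDefect ρ a (2 ^ k * t) z =
      ((2 : ℂ) ^ k)⁻¹ * thermalLogZ ρ a (2 ^ k * t) z - ((2 : ℂ) ^ (k + 1))⁻¹ * thermalLogZ ρ a (2 ^ (k + 1) * t) z := by
  rw [coldLogDefect_eq, show (2 * (2 ^ k * t) : ℕ) = 2 ^ (k + 1) * t by ring, pow_succ]
  have h2 : (2 : ℂ) ^ k ≠ 0 := pow_ne_zero _ two_ne_zero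
  field_simp

/-- One dyadic step for the volume discrepancies:
`2^{−(k+1)}·coldVolumeDiscrepancy(2^k t) = 2^{−k}·volumeDiscrepancy(2^k t) − 2^{−(k+1)}·volumeDiscrepancy(2^{k+1} t)`. -/
theorem inv_two_pow_mul_coldVolumeDiscrepancy (a a' t k : ℕ) (z : ℂ) :
    ((2 : ℂ) ^ (k + 1))⁻¹ * coldVolumeDiscrepancy ρ a a' (2 ^ k * t) z =
      ((2 : ℂ) ^ k)⁻¹ * volumeDiscrepancy ρ a a' (2 ^ k * t) z -
        ((2 : ℂ) ^ (k + 1))⁻¹ * volumeDiscrepancy ρ a a' (2 ^ (k + 1) * t) z := by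
  rw [coldVolumeDiscrepancy_eq, show (2 * (2 ^ k * t) : ℕ) = 2 ^ (k + 1) * t by ring, pow_succ]
  have h2 : (2 : ℂ) ^ k ≠ 0 := pow_ne_zero _ two_ne_zero
  field_simp

/-- **Finite dyadic telescoping**: `thermalLogZ ρ a t z = Σ_{k<K} 2^{−(k+1)}·coldLogDefect ρ a (2^k t) z + 2^{−K}·thermalLogZ ρ a (2^K t) z`
for every `K` (exact, every `z`). -/
theorem thermalLogZ_eq_sum_add (a t K : ℕ) (z : ℂ) :
    thermalLogZ ρ a t z = ∑ k ∈ Finset.range K, ((2 : ℂ) ^ (k + 1))⁻¹ * coldLogDefect ρ a (2 ^ k * t) z +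
      ((2 : ℂ) ^ K)⁻¹ * thermalLogZ ρ a (2 ^ K * t) z := by
  induction K with
  | zero => simp
  | succ K ih => rw [Finset.sum_range_succ, inv_two_pow_mul_coldLogDefect, ih]; ring

/-- **Finite dyadic telescoping for the volume discrepancies**:
`volumeDiscrepancy ρ a a' t z = Σ_{k<K} 2^{−(k+1)}·coldVolumeDiscrepancy ρ a a' (2^k t) z + 2^{−K}·volumeDiscrepancy ρ a a' (2^K t) z`. -/
theorem volumeDiscrepancy_eq_sum_add (a a' t K : ℕ) (z : ℂ) :
    volumeDiscrepancy ρ a a' t z = ∑ k ∈ Finset.range K, ((2 : ℂ) ^ (k + 1))⁻¹ * coldVolumeDiscrepancy ρ a a' (2 ^ k * t) z +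
      ((2 : ℂ) ^ K)⁻¹ * volumeDiscrepancy ρ a a' (2 ^ K * t) z := by
  induction K with
  | zero => simp
  | succ K ih => rw [Finset.sum_range_succ, inv_two_pow_mul_coldVolumeDiscrepancy, ih]; ring

/-- The norm of the dyadic weight: `‖(2^K)⁻¹‖ = (1/2)^K`. -/
theorem norm_inv_two_pow (K : ℕ) : ‖((2 : ℂ) ^ K)⁻¹‖ = (1 / 2 : ℝ) ^ K := by
  rw [norm_inv, norm_pow, Complex.norm_ofNat, one_div, inv_pow]

/-- On the closed disc the dyadic remainder is small: `‖2^{−K}·thermalLogZ ρ a (2^K t) z‖ ≤ 48e·a³·(1/2)^K`. -/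
theorem norm_remainder_le (hρ : Continuous ρ) {a t : ℕ} (ha : 0 < a) (ht : 1 ≤ t) (K : ℕ) {z : ℂ}
    (hz : ‖z‖ ≤ strongCouplingRadius ρ) :
    ‖((2 : ℂ) ^ K)⁻¹ * thermalLogZ ρ a (2 ^ K * t) z‖ ≤ 48 * Real.exp 1 * (a : ℝ) ^ 3 * (1 / 2 : ℝ) ^ K := by
  rw [norm_mul, norm_inv_two_pow]
  have hT : 1 ≤ 2 ^ K * t := le_mul_of_one_le_of_le Nat.one_le_two_pow ht
  have h := norm_thermalLogZ_le_unif ρ hρ ha hT hz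
  have h0 : (0 : ℝ) ≤ (1 / 2 : ℝ) ^ K := by positivity
  nlinarith [mul_le_mul_of_nonneg_left h h0]

/-- **The thermal free energy is the dyadic sum of cold log-defects of finite boxes**: on `‖z‖ ≤ r_ρ` (`a, t ≥ 1`),
`thermalLogZ ρ a t z = Σ_{k ≥ 0} 2^{−(k+1)}·coldLogDefect ρ a (2^k t) z` — the tube-rate-normalised free energy of the spatial torus is
recovered from the partition functions of the finite boxes `a³ × 2^k t` alone. -/
theorem hasSum_coldLogDefect (hρ : Continuous ρ) {a t : ℕ} (ha : 0 < a) (ht : 1 ≤ t) {z : ℂ} (hz : ‖z‖ ≤ strongCouplingRadius ρ) :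
    HasSum (fun k : ℕ => ((2 : ℂ) ^ (k + 1))⁻¹ * coldLogDefect ρ a (2 ^ k * t) z) (thermalLogZ ρ a t z) := by
  -- summable: each term is a difference of two remainders, both `≤ 48e a³ (1/2)^k`
  have hbound : ∀ k : ℕ, ‖((2 : ℂ) ^ (k + 1))⁻¹ * coldLogDefect ρ a (2 ^ k * t) z‖ ≤ 2 * (48 * Real.exp 1 * (a : ℝ) ^ 3) * (1 / 2 : ℝ) ^ k := by
    intro k
    rw [inv_two_pow_mul_coldLogDefect]
    refine (norm_sub_le _ _).trans ?_
    have h1 := norm_remainder_le ρ hρ ha ht k hz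
    have h2 := norm_remainder_le ρ hρ ha ht (k + 1) hz
    have h3 : (1 / 2 : ℝ) ^ (k + 1) ≤ (1 / 2 : ℝ) ^ k := pow_le_pow_of_le_one (by norm_num) (by norm_num) (Nat.le_succ k)
    have h0 : (0 : ℝ) ≤ 48 * Real.exp 1 * (a : ℝ) ^ 3 := by positivity
    nlinarith [mul_le_mul_of_nonneg_left h3 h0]
  have hsum : Summable fun k : ℕ => ((2 : ℂ) ^ (k + 1))⁻¹ * coldLogDefect ρ a (2 ^ k * t) z :=
    Summable.of_norm_bounded (g := fun k : ℕ => 2 * (48 * Real.exp 1 * (a : ℝ) ^ 3) * (1 / 2 : ℝ) ^ k)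
      ((summable_geometric_of_lt_one (by norm_num) (by norm_num)).mul_left _) hbound
  -- the partial sums converge to `thermalLogZ` since the remainder tends to zero
  refine hsum.hasSum_iff_tendsto_nat.2 ?_
  have hrem : Tendsto (fun K : ℕ => ((2 : ℂ) ^ K)⁻¹ * thermalLogZ ρ a (2 ^ K * t) z) atTop (𝓝 0) := by
    rw [tendsto_zero_iff_norm_tendsto_zero]
    have hg : Tendsto (fun K : ℕ => 48 * Real.exp 1 * (a : ℝ) ^ 3 * (1 / 2 : ℝ) ^ K) atTop (𝓝 0) := by
      simpa using (tendsto_pow_atTop_nhds_zero_of_lt_one (r := (1 / 2 : ℝ)) (by norm_num) (by norm_num)).const_mul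
        (48 * Real.exp 1 * (a : ℝ) ^ 3)
    exact squeeze_zero (fun K => norm_nonneg _) (fun K => norm_remainder_le ρ hρ ha ht K hz) hg
  have heq : (fun K : ℕ => ∑ k ∈ Finset.range K, ((2 : ℂ) ^ (k + 1))⁻¹ * coldLogDefect ρ a (2 ^ k * t) z) =
      fun K : ℕ => thermalLogZ ρ a t z - ((2 : ℂ) ^ K)⁻¹ * thermalLogZ ρ a (2 ^ K * t) z := by
    funext K
    rw [eq_sub_iff_add_eq, ← thermalLogZ_eq_sum_add]
  rw [heq]
  simpa using (tendsto_const_nhds (x := thermalLogZ ρ a t z)).sub hrem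

/-- The same for the volume discrepancies: on `‖z‖ ≤ r_ρ`,
`volumeDiscrepancy ρ a a' t z = Σ_{k ≥ 0} 2^{−(k+1)}·coldVolumeDiscrepancy ρ a a' (2^k t) z`. -/
theorem hasSum_coldVolumeDiscrepancy (hρ : Continuous ρ) {a a' t : ℕ} (ha : 0 < a) (ha' : 0 < a') (ht : 1 ≤ t) {z : ℂ}
    (hz : ‖z‖ ≤ strongCouplingRadius ρ) :
    HasSum (fun k : ℕ => ((2 : ℂ) ^ (k + 1))⁻¹ * coldVolumeDiscrepancy ρ a a' (2 ^ k * t) z) (volumeDiscrepancy ρ a a' t z) := by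
  have h1 := ((hasSum_coldLogDefect ρ hρ ha' ht hz).div_const ((a' : ℂ) ^ 3)).sub
    ((hasSum_coldLogDefect ρ hρ ha ht hz).div_const ((a : ℂ) ^ 3))
  refine h1.congr_fun fun k => ?_
  unfold coldVolumeDiscrepancy
  ring

end Telescoping

/-! ## §3 Jets: cold jets at the dyadic periods ⇒ thermal jets, and back -/

section Jets

/-- **Cold jets ⇒ a thermal estimate.**  If `coldVolumeDiscrepancy ρ a a' (2^k t) =O[𝓝 0] z^m` for every `k`, then
`‖volumeDiscrepancy ρ a a' t z‖ ≤ 288e·(‖z‖/(r_ρ/2))^m` for `‖z‖ ≤ r_ρ/2` (Schwarz per dyadic period with §1's period-uniform constant,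
dyadic weights `Σ 2^{−(k+1)} ≤ 1`, remainder `→ 0`). -/
theorem norm_volumeDiscrepancy_le_of_cold_isBigO (hρ : Continuous ρ) {a a' t m : ℕ} (ha : 0 < a) (ha' : 0 < a') (ht : 1 ≤ t)
    (hO : ∀ k : ℕ, (fun z : ℂ => coldVolumeDiscrepancy ρ a a' (2 ^ k * t) z) =O[𝓝 (0 : ℂ)] fun z : ℂ => z ^ m)
    {z : ℂ} (hz : ‖z‖ ≤ strongCouplingRadius ρ / 2) :
    ‖volumeDiscrepancy ρ a a' t z‖ ≤ 288 * Real.exp 1 * (‖z‖ / (strongCouplingRadius ρ / 2)) ^ m := by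
  have hr := strongCouplingRadius_pos ρ
  have hzR : ‖z‖ ≤ strongCouplingRadius ρ := hz.trans (half_le_self hr.le)
  set x : ℝ := (‖z‖ / (strongCouplingRadius ρ / 2)) ^ m with hx
  have hx0 : 0 ≤ x := by positivity
  -- per dyadic period, Schwarz with the period-uniform constant
  have hk : ∀ k : ℕ, ‖coldVolumeDiscrepancy ρ a a' (2 ^ k * t) z‖ ≤ 288 * Real.exp 1 * x := fun k =>
    norm_coldVolumeDiscrepancy_le_of_isBigO_unif ρ hρ ha ha' (le_mul_of_one_le_of_le Nat.one_le_two_pow ht) (hO k) hz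
  -- the dyadic weights sum to at most one
  have hw : ∀ K : ℕ, ∑ k ∈ Finset.range K, (1 / 2 : ℝ) ^ (k + 1) ≤ 1 := by
    intro K
    have h : ∑ k ∈ Finset.range K, (1 / 2 : ℝ) ^ (k + 1) = 1 / 2 * ∑ k ∈ Finset.range K, (1 / 2 : ℝ) ^ k := by
      rw [Finset.mul_sum]
      refine Finset.sum_congr rfl fun k _ => ?_
      rw [pow_succ, mul_comm]
    rw [h]
    have := sum_geometric_two_le K
    linarith
  -- the bound at every dyadic depth `K`
  have hK : ∀ K : ℕ, ‖volumeDiscrepancy ρ a a' t z‖ ≤ 288 * Real.exp 1 * x + 96 * Real.exp 1 * (1 / 2 : ℝ) ^ K := by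
    intro K
    rw [volumeDiscrepancy_eq_sum_add ρ a a' t K z]
    refine (norm_add_le _ _).trans (add_le_add ?_ ?_)
    · refine (norm_sum_le _ _).trans ?_
      calc ∑ k ∈ Finset.range K, ‖((2 : ℂ) ^ (k + 1))⁻¹ * coldVolumeDiscrepancy ρ a a' (2 ^ k * t) z‖
          ≤ ∑ k ∈ Finset.range K, (1 / 2 : ℝ) ^ (k + 1) * (288 * Real.exp 1 * x) := by
            refine Finset.sum_le_sum fun k _ => ?_
            rw [norm_mul, norm_inv_two_pow]
            exact mul_le_mul_of_nonneg_left (hk k) (by positivity)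
        _ = (∑ k ∈ Finset.range K, (1 / 2 : ℝ) ^ (k + 1)) * (288 * Real.exp 1 * x) := by rw [Finset.sum_mul]
        _ ≤ 1 * (288 * Real.exp 1 * x) :=
            mul_le_mul_of_nonneg_right (hw K) (by positivity)
        _ = 288 * Real.exp 1 * x := one_mul _
    · rw [norm_mul, norm_inv_two_pow]
      have h := norm_volumeDiscrepancy_le_unif ρ hρ ha ha' (le_mul_of_one_le_of_le Nat.one_le_two_pow ht) (T := 2 ^ K * t) hzR
      have h0 : (0 : ℝ) ≤ (1 / 2 : ℝ) ^ K := by positivity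
      nlinarith [mul_le_mul_of_nonneg_left h h0]
  -- let `K → ∞`
  have hlim : Tendsto (fun K : ℕ => 288 * Real.exp 1 * x + 96 * Real.exp 1 * (1 / 2 : ℝ) ^ K) atTop
      (𝓝 (288 * Real.exp 1 * x)) := by
    simpa using ((tendsto_pow_atTop_nhds_zero_of_lt_one (r := (1 / 2 : ℝ)) (by norm_num) (by norm_num)).const_mul
      (96 * Real.exp 1)).const_add (288 * Real.exp 1 * x)
  exact ge_of_tendsto' hlim hK

/-- **Cold jets ⇒ thermal jets.**  If `coldVolumeDiscrepancy ρ a a' (2^k t) =O[𝓝 0] z^m` for every `k ≥ 0`, then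
`volumeDiscrepancy ρ a a' t =O[𝓝 0] z^m` (`a, a', t ≥ 1`, any order `m`). -/
theorem isBigO_volumeDiscrepancy_of_cold (hρ : Continuous ρ) {a a' t m : ℕ} (ha : 0 < a) (ha' : 0 < a') (ht : 1 ≤ t)
    (hO : ∀ k : ℕ, (fun z : ℂ => coldVolumeDiscrepancy ρ a a' (2 ^ k * t) z) =O[𝓝 (0 : ℂ)] fun z : ℂ => z ^ m) :
    (fun z : ℂ => volumeDiscrepancy ρ a a' t z) =O[𝓝 (0 : ℂ)] fun z : ℂ => z ^ m := by
  have hr := strongCouplingRadius_pos ρ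
  have hr2 : 0 < strongCouplingRadius ρ / 2 := half_pos hr
  refine IsBigO.of_bound (288 * Real.exp 1 / (strongCouplingRadius ρ / 2) ^ m) ?_
  filter_upwards [Metric.closedBall_mem_nhds (0 : ℂ) hr2] with z hz
  rw [Metric.mem_closedBall, dist_zero_right] at hz
  have h := norm_volumeDiscrepancy_le_of_cold_isBigO ρ hρ ha ha' ht hO hz
  rw [norm_pow, div_mul_eq_mul_div, mul_div_assoc, ← div_pow]
  exact h

/-- **Thermal jets ⇒ cold jets** (the easy direction): `coldVolumeDiscrepancy(t) = 2·volumeDiscrepancy(t) − volumeDiscrepancy(2t)`. -/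
theorem isBigO_coldVolumeDiscrepancy_of_thermal {a a' t m : ℕ}
    (h1 : (fun z : ℂ => volumeDiscrepancy ρ a a' t z) =O[𝓝 (0 : ℂ)] fun z : ℂ => z ^ m)
    (h2 : (fun z : ℂ => volumeDiscrepancy ρ a a' (2 * t) z) =O[𝓝 (0 : ℂ)] fun z : ℂ => z ^ m) :
    (fun z : ℂ => coldVolumeDiscrepancy ρ a a' t z) =O[𝓝 (0 : ℂ)] fun z : ℂ => z ^ m := by
  have h := (h1.const_mul_left (2 : ℂ)).sub h2
  refine h.congr' (Eventually.of_forall fun z => ?_) EventuallyEq.rfl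
  simp only [coldVolumeDiscrepancy_eq]

end Jets

/-! ## §4 The two jet stubs of line 7b are equivalent -/

section Stubs

/-- **The tube-rate twin from the finite currency**: `ColdFreeEnergyVolumeJets → ThermalFreeEnergyVolumeJets` — jet agreement of the
cold log-defect densities of the finite boxes `a³×T`, `a³×2T` (all `T ≥ 4`) gives jet agreement of the thermal free-energy densities
(dyadic periods `T = 2^k t`). -/
theorem thermalFreeEnergyVolumeJets_of_coldJets (h : ColdFreeEnergyVolumeJets) : ThermalFreeEnergyVolumeJets := by
  intro G _ _ _ _
  letI : MeasurableSpace G := borel G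
  haveI : BorelSpace G := ⟨rfl⟩
  intro r a a' t ha haa' ht
  exact isBigO_volumeDiscrepancy_of_cold r.ρ r.continuous (by omega) (by omega) (by omega) fun k =>
    h G r a a' (2 ^ k * t) ha haa' (le_mul_of_one_le_of_le Nat.one_le_two_pow ht)

/-- The easy converse: `ThermalFreeEnergyVolumeJets → ColdFreeEnergyVolumeJets`. -/
theorem coldFreeEnergyVolumeJets_of_thermalJets (h : ThermalFreeEnergyVolumeJets) : ColdFreeEnergyVolumeJets := by
  intro G _ _ _ _
  letI : MeasurableSpace G := borel G
  haveI : BorelSpace G := ⟨rfl⟩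
  intro r a a' t ha haa' ht
  exact isBigO_coldVolumeDiscrepancy_of_thermal r.ρ (h G r a a' t ha haa' ht) (h G r a a' (2 * t) ha haa' (by omega))

/-- **The two typed jet stubs of line 7b are equivalent**: `ThermalFreeEnergyVolumeJets ↔ ColdFreeEnergyVolumeJets`. -/
theorem thermalFreeEnergyVolumeJets_iff_coldJets : ThermalFreeEnergyVolumeJets ↔ ColdFreeEnergyVolumeJets :=
  ⟨coldFreeEnergyVolumeJets_of_thermalJets, thermalFreeEnergyVolumeJets_of_coldJets⟩

end Stubs

end Summit.QuantumFields.YangMills.Theorems.GlueballBandRecursion.Thermal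

end
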